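import Literature.Computability.QuantumComplexity.CountingSimulation
import Literature.Computability.Cryptography.ClassBQP
import Literature.Computability.Complexity.Counting
import Literature.Computability.Complexity.Oracle
import Literature.Computability.Complexity.PolyHierarchy
import HarnessLib

/-!
# Fortnow–Rogers 1999 §3 relative to an oracle: `GapP^O`, `AWPP^O`, and the ingredients of the relativized world with `P = BQP` and an infinite polynomial-time hierarchy

Family `quantum-advantage` (topic `Computability/QuantumComplexity`), namespace
`Literature.QuantumAdvantage`. Companion of `CountingSimulation.lean` (the unrelativized `AWPP` and the
fact `BQP_subset_AWPP`, **quantum-advantage.S17**), serving the decomposition of the barrier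
fact `Literature.Barriers.QuantumAdvantage.fortnowRogers1999_cor37`
(`Literature/Barriers/QuantumAdvantage/SupremacyTheoremsNonRelativizing.lean`): Fortnow–Rogers,
*Complexity limitations on quantum computation*, JCSS 59 (1999), Cor. 3.7 (arXiv numbering):
"There exists a relativized world where `P = BQP` and the polynomial-time hierarchy is
infinite", typed there as
`∃ A, PRel (Oracle.ofLanguage A) = BQPRel A ∧ ∀ k, Σₖ^A ≠ Σₖ₊₁^A`.

**The printed proof of Cor. 3.7** (§3, p. 5): "We can create an oracle `H` by starting with an
oracle making `P = PSPACE` and joining a generic `G` to that. Because the polynomial-time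
hierarchy is infinite relative to generic oracles and because Theorem 3.1 relativizes, we can
get some interesting relativized worlds." Here Thm. 3.1 is `BQP ⊆ AWPP` (via Lemma 3.2: the
acceptance probability of a polynomial-time quantum machine is `f(x)/5^{2t(|x|)}` for a `GapP`
function `f`), and Thm. 3.6 (Fenner–Fortnow–Kurtz–Li, Nisan–Szegedy) is "If `P = PSPACE`
(unrelativized) then `P^G = AWPP^G` for any generic `G`" (Fenner–Fortnow–Kurtz–Li 2003,
Thm. 6.18 (2), rerelativized to `B ⊕ G` for a `PSPACE`-complete `B` on pp. 33–34; Cohen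
generics separate all levels of `PH`, ibid. §1 p. 3, after Yao–Håstad). So, relative to
`A = H ⊕ G`: `P^A ⊆ BQP^A ⊆ AWPP^A = P^A`, and `PH^A` is infinite.

**What this file adds.**

* The relativized counting classes `GapPRel O = GapP^O` (differences of two `#P^O` functions,
  over the tree's `SharpPRel O`) and `AWPPRel O = AWPP^O` (Fenner's one-`GapP`-function form —
  the literal `O`-relativization of the tree's `AWPP`), with unfolding lemmas, monotonicity in
  the base class `P^O`, the inclusions of the unrelativized classes (under the tree fact
  `P_subset_PRel`) and the empty-oracle anchors `SharpPRel_empty`, `GapPRel_empty`,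
  `AWPPRel_empty` (under the tree fact `PRel_empty`).
* Two ingredients of Cor. 3.7 as named facts, each as printed and relativized to the tree's
  models (`PRel`, `SigmaPRel`: G01 transcript model at the language oracle `Oracle.ofLanguage A`;
  `BQPRel A`: Q2 uniform Clifford+T families with XOR-query gates to `A`):
  `PRel_ofLanguage_subset_BQPRel` (`P^A ⊆ BQP^A` for every `A`; Bernstein–Vazirani Thm. 8.2 with
  §8.3, used in Fortnow–Rogers §2.3 and Thm. 4.2) and `BQPRel_subset_AWPPRel` (`BQP^A ⊆ AWPP^A`
  for every `A`: "Theorem 3.1 relativizes"). The third ingredient — the oracle of the proof, an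
  `A` (in print `H ⊕ G`) with `P^A = AWPP^A` and `Σₖ^A ≠ Σₖ₊₁^A` for every `k` — is NOT a named
  fact here (see Revision 3): it is the unnumbered glue step of the printed proof, and it enters
  the assemblies below as the explicit hypothesis `h₃`. Its content is two published results,
  vendored downstream as the named facts `fennerFortnowKurtzLi2003_thm618_awpp` (Thm. 3.6 =
  Fenner–Fortnow–Kurtz–Li Thm. 6.18 (2), rerelativized to a `PSPACE`-complete set) and
  `isInfinitePHRel_join_generic` ("the polynomial-time hierarchy is infinite relative to generic
  oracles") of `Literature/Barriers/QuantumAdvantage/FortnowRogersOracle.lean`, which PROVES the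
  oracle-existence statement from them (`exists_oracle_PRel_eq_AWPPRel_infinitePH_of_generic`,
  with the existence of generic oracles, `Complexity/GenericOracles.lean`, and of a
  `PSPACE`-complete set, `exists_isComplete_PSPACE_holds`).
* Proved: the oracle-wise sandwich `PRel_eq_BQPRel_of_PRel_eq_AWPPRel` — at every `A` with
  `P^A = AWPP^A`, `P^A ⊆ BQP^A ⊆ AWPP^A = P^A` gives `P^A = BQP^A`; the assembly
  `exists_oracle_PRel_eq_BQPRel_infinitePH_of_parts` — the two facts and the hypothesis `h₃` give
  `∃ A, P^A = BQP^A ∧ ∀ k, Σₖ^A ≠ Σₖ₊₁^A`, i.e. the definiens of `fortnowRogers1999_cor37` (the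
  barrier's sibling proof file restates it against that `def`); and the consistency check
  `BQP_subset_AWPP_of_BQPRel_subset_AWPPRel`: the relativized Thm. 3.1 at the empty oracle is the
  tree's unrelativized fact `BQP_subset_AWPP` (through `BQP_subset_BQPRel` and `AWPPRel_empty`).
* Revision 2 (appended for the barrier's proof file
  `Literature/Barriers/QuantumAdvantage/SupremacyTheoremsNonRelativizingProofs.lean`, which also
  decomposes Fortnow–Rogers Thm. 4.2, `P^C = BPP^C = BQP^C ≠ UP^C ∩ coUP^C`): the named fact
  `BPPRel_ofLanguage_subset_BQPRel` (`BPP^A ⊆ BQP^A` for every `A`; Bernstein–Vazirani Thm. 8.3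
  with §8.3 — "and so `P = BPP = BQP`", Fortnow–Rogers p. 7), from which the ingredient
  `PRel_ofLanguage_subset_BQPRel` is DERIVED under the tree fact `PRel_subset_BPPRel`
  (`PRel_ofLanguage_subset_BQPRel_of_BPPRel`), so that the decompositions of Cor. 3.7 and
  Thm. 4.2 share one classical-in-quantum leaf; the anchor `BPP_subset_BQP_of_BPPRel` (at the
  empty oracle the new fact is the tree's `BPP ⊆ BQP`, under `PRel_empty` and `BQPRel_zero`);
  and the assembly `exists_oracle_PRel_eq_BPPRel_eq_BQPRel_infinitePH_of_parts`
  (`P^A = BPP^A = BQP^A` with `PH^A` infinite).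
* Revision 3 (D-0026 review of the decomposition of `fortnowRogers1999_cor37`): the former third
  named fact of this file, `exists_oracle_PRel_eq_AWPPRel_infinitePH :
  ∃ A, P^A = AWPP^A ∧ ∀ k, Σₖ^A ≠ Σₖ₊₁^A`, is merged back into the proof obligation of the barrier
  fact: the `def` is deleted and its statement is kept verbatim as the hypothesis `h₃` of the
  three assemblies (and, downstream, as the conclusion of
  `exists_oracle_PRel_eq_AWPPRel_infinitePH_of_generic`). Given the two inclusion facts it is
  Cor. 3.7 with `BQP` replaced by `AWPP` — a slice of the parent's proof rather than a distinct
  citable result — and its own two halves are the named facts downstream; decompositions do not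
  recurse. No statement of a surviving declaration changed meaning (`h₃` is the old definiens).

## Design notes

* `AWPPRel` relativizes Fenner's form of `AWPP` (one `GapP` function, constant error `1/3`,
  dyadic denominator `2^{p(|x|)}`), exactly as the tree's `AWPP` (`CountingSimulation.lean`);
  Fortnow–Rogers' Def. 2.5 / Fenner–Fortnow–Kurtz–Li's Def. 6.1 (error `2^{-r(n)}` for every
  polynomial `r`, arbitrary positive `FP` denominator) gives the same class by a `GapP`-closure
  and amplification argument which relativizes (Fenner–Fortnow–Kurtz–Li 2003, p. 25; §2, p. 7:
  "All the definitions above relativize in the usual way").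
* Genericity (Cohen conditions, Fortnow–Rogers §2.6) is not needed in this file: the oracle of
  the proof of Cor. 3.7 appears only as the hypothesis `h₃` of the assemblies (the existence
  statement which the proof extracts from Thm. 3.6 and the generic separation of `PH`, for one
  oracle). Cohen conditions, generic oracles and their existence for countable families of
  requirements are formalized downstream (`Complexity/GenericOracles.lean`), where
  `FortnowRogersOracle.lean` states the two halves (Thm. 3.6 rerelativized for every generic;
  `PH^{B ⊕ G}` infinite for every generic, Yao–Håstad) and proves `h₃` from them.
* "`PH^A` is infinite" is spelled `∀ k, SigmaPRel O k ≠ SigmaPRel O (k + 1)`, syntactically the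
  barrier file's `IsInfinitePHRel O` (not imported here: `Literature/Barriers` imports
  `Literature/Computability`, not conversely).
* The anchors take the tree facts `PRel_empty : P^∅ = P` and `P_subset_PRel : P ⊆ P^O` as
  hypotheses; both are discharged in the tree (`PRel_empty_holds`,
  `Complexity/OracleEmpty.lean`; `P_subset_PRel_holds`, `Complexity/OracleProofs.lean`), whose
  machine-level imports this statement file avoids.

## References

* [FortnowRogers1999JCSS] L. Fortnow, J. Rogers, *Complexity limitations on quantum
  computation*, JCSS 59 (1999) 240–252 = arXiv:cs/9811023 (held: `lit read arxiv:cs/9811023`,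
  arXiv numbering): §2.3 p. 3 ("`BQP` machines can simulate deterministic Turing machines"),
  Def. 2.5 (AWPP, p. 4), §2.6 (generic oracles, p. 4), Thm. 3.1, Lemma 3.2, Thm. 3.6, Cor. 3.7
  (p. 5), Thm. 4.2 (p. 7, `P^C = BPP^C = BQP^C`).
* [FennerFortnowKurtzLi2003IC] S. Fenner, L. Fortnow, S. Kurtz, L. Li, *An oracle builder's
  toolkit*, Inform. and Comput. 182 (2003) 95–136 (held:
  `lit read paper:doi-10-1016-s0890-5401-03-00018-x`): §1 p. 3 (Cohen generics separate the
  polynomial hierarchy, after Yao), §2 p. 7, §4 (Cohen genericity, Lemma 4.1, Cor. 4.6), Def. 6.1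
  and p. 25 (AWPP; Fenner's constant-error form), Cor. 6.14 (p. 32), Thm. 6.18 (2) (p. 33),
  pp. 33–34 (rerelativization to `B ⊕ G`, `B` `PSPACE`-complete).
* [BernsteinVazirani1997SICOMP] E. Bernstein, U. Vazirani, *Quantum complexity theory*, SIAM J.
  Comput. 26 (1997) 1411–1473 (held): Thm. 8.2 (`P ⊆ EQP`), Thm. 8.3 (`BPP ⊆ BQP`), p. 1451;
  §8.3 (oracle QTMs).
* [Fenner2003] S. Fenner, *PP-lowness and a simple definition of AWPP*, Theory Comput. Syst. 36
  (2003) 199–212, Thm. 1.2, Cor. 3.2 (as cited at the tree's `AWPP`).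
* [FennerFortnowKurtz1994] S. Fenner, L. Fortnow, S. Kurtz, *Gap-definable counting classes*,
  JCSS 48 (1994), §3 (`GapP`; as cited at the tree's `GapP`).
-/

noncomputable section

namespace Literature.Computability.QuantumComplexity

open _root_.Computability Complexity Complexity.Classes Cryptography

/-! ### `GapP` and `AWPP` relative to an oracle -/

/-- `GapPRel O = GapP^O`: the differences of two `#P^O` functions,
`g ∈ GapP^O ↔ ∃ f₁ f₂ ∈ #P^O, ∀ x, g x = f₁ x - f₂ x` (in `ℤ`) — the tree's `GapP` with
`SharpPRel O` for `SharpP`. [cite: FennerFortnowKurtz1994, §3] [cite: FennerFortnowKurtzLi2003IC, §2 p. 7 (definitions relativize)] -/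
def GapPRel (O : Oracle) : Set (List Bool → ℤ) :=
  {g | ∃ f₁ ∈ SharpPRel O, ∃ f₂ ∈ SharpPRel O, ∀ x : List Bool, g x = (f₁ x : ℤ) - (f₂ x : ℤ)}

/-- `AWPPRel O = AWPP^O`, in Fenner's `GapP` form relativized to `O`: `L ∈ AWPP^O` iff there are
`g ∈ GapP^O` and a polynomial `p` with `x ∈ L → 2/3 ≤ g(x)/2^{p(|x|)} ≤ 1` and
`x ∉ L → 0 ≤ g(x)/2^{p(|x|)} ≤ 1/3` (written multiplicatively in `ℤ`) — the tree's `AWPP`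
(`CountingSimulation.lean`) with `GapPRel O` for `GapP`. Fortnow–Rogers' Def. 2.5 (error
`2^{-q(m)}` for every polynomial `q`, any positive polynomial-time denominator `g(1^m)`) defines
the same class relative to every oracle (Fenner's amplification, a relativizing `GapP`-closure
argument). [cite: FortnowRogers1999JCSS, Def. 2.5 (arXiv numbering)] [cite: FennerFortnowKurtzLi2003IC, Def. 6.1 and p. 25] [cite: Fenner2003, Thm. 1.2 and Cor. 3.2] -/
def AWPPRel (O : Oracle) : Set (Language Bool) :=
  {L | ∃ g ∈ GapPRel O, ∃ p : Polynomial ℕ, ∀ x : List Bool,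
    (x ∈ L → 2 * (2 : ℤ) ^ p.eval x.length ≤ 3 * g x ∧ g x ≤ (2 : ℤ) ^ p.eval x.length) ∧
    (x ∉ L → 0 ≤ g x ∧ 3 * g x ≤ (2 : ℤ) ^ p.eval x.length)}

/-- Unfolding lemma for `GapPRel`. [cite: FennerFortnowKurtz1994, §3] -/
theorem mem_GapPRel_iff {O : Oracle} {g : List Bool → ℤ} :
    g ∈ GapPRel O ↔
      ∃ f₁ ∈ SharpPRel O, ∃ f₂ ∈ SharpPRel O, ∀ x : List Bool, g x = (f₁ x : ℤ) - (f₂ x : ℤ) :=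
  Iff.rfl

/-- Unfolding lemma for `AWPPRel`. [cite: Fenner2003, Thm. 1.2] -/
theorem mem_AWPPRel_iff {O : Oracle} {L : Language Bool} :
    L ∈ AWPPRel O ↔ ∃ g ∈ GapPRel O, ∃ p : Polynomial ℕ, ∀ x : List Bool,
      (x ∈ L → 2 * (2 : ℤ) ^ p.eval x.length ≤ 3 * g x ∧ g x ≤ (2 : ℤ) ^ p.eval x.length) ∧
      (x ∉ L → 0 ≤ g x ∧ 3 * g x ≤ (2 : ℤ) ^ p.eval x.length) :=
  Iff.rfl

/-! ### Dependence on the oracle only through `P^O` -/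

/-- `#P^O` is monotone in the base class `P^O`. [folklore] -/
theorem SharpPRel_mono {O O' : Oracle} (h : PRel O ⊆ PRel O') : SharpPRel O ⊆ SharpPRel O' := by
  rintro f ⟨R, hR, p, hp⟩
  exact ⟨R, h hR, p, hp⟩

/-- `GapP^O` is monotone in the base class `P^O`. [folklore] -/
theorem GapPRel_mono {O O' : Oracle} (h : PRel O ⊆ PRel O') : GapPRel O ⊆ GapPRel O' := by
  rintro g ⟨f₁, h₁, f₂, h₂, hg⟩
  exact ⟨f₁, SharpPRel_mono h h₁, f₂, SharpPRel_mono h h₂, hg⟩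

/-- `AWPP^O` is monotone in the base class `P^O`. [folklore] -/
theorem AWPPRel_mono {O O' : Oracle} (h : PRel O ⊆ PRel O') : AWPPRel O ⊆ AWPPRel O' := by
  rintro L ⟨g, hg, p, hp⟩
  exact ⟨g, GapPRel_mono h hg, p, hp⟩

/-- `#P ⊆ #P^O`, from the tree fact `P ⊆ P^O` (`P_subset_PRel`, discharged as
`P_subset_PRel_holds`). [folklore] -/
theorem SharpP_subset_SharpPRel (hP : P_subset_PRel) (O : Oracle) : SharpP ⊆ SharpPRel O := by
  rintro f ⟨R, hR, p, hp⟩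
  exact ⟨R, hP O hR, p, hp⟩

/-- `GapP ⊆ GapP^O`, from `P ⊆ P^O`. [folklore] -/
theorem GapP_subset_GapPRel (hP : P_subset_PRel) (O : Oracle) : GapP ⊆ GapPRel O := by
  rintro g ⟨f₁, h₁, f₂, h₂, hg⟩
  exact ⟨f₁, SharpP_subset_SharpPRel hP O h₁, f₂, SharpP_subset_SharpPRel hP O h₂, hg⟩

/-- `AWPP ⊆ AWPP^O`, from `P ⊆ P^O`. [folklore] -/
theorem AWPP_subset_AWPPRel (hP : P_subset_PRel) (O : Oracle) : AWPP ⊆ AWPPRel O := by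
  rintro L ⟨g, hg, p, hp⟩
  exact ⟨g, GapP_subset_GapPRel hP O hg, p, hp⟩

/-! ### Anchors at the empty oracle -/

/-- `#P^∅ = #P`, from the tree fact `P^∅ = P` (`PRel_empty`, discharged as `PRel_empty_holds`).
[folklore] -/
theorem SharpPRel_empty (hE : PRel_empty) : SharpPRel Oracle.empty = SharpP := by
  have h : PRel Oracle.empty = P := hE
  unfold SharpPRel SharpP
  rw [h]

/-- `GapP^∅ = GapP`. [folklore] -/
theorem GapPRel_empty (hE : PRel_empty) : GapPRel Oracle.empty = GapP := by
  unfold GapPRel GapP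
  rw [SharpPRel_empty hE]

/-- `AWPP^∅ = AWPP`. [folklore] -/
theorem AWPPRel_empty (hE : PRel_empty) : AWPPRel Oracle.empty = AWPP := by
  unfold AWPPRel AWPP
  rw [GapPRel_empty hE]

/-- The same anchor at the empty *language* oracle `Oracle.ofLanguage 0` (definitionally
`Oracle.empty`), the form in which language-indexed statements specialise. [folklore] -/
theorem AWPPRel_ofLanguage_zero (hE : PRel_empty) : AWPPRel (Oracle.ofLanguage 0) = AWPP :=
  AWPPRel_empty hE

/-! ### The ingredients of Fortnow–Rogers Cor. 3.7 (named facts) -/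

/-- **`P^A ⊆ BQP^A` for every oracle language `A`**: a polynomial-time oracle machine (G01
transcript model, oracle `Oracle.ofLanguage A`) is simulated exactly by a polynomial-time uniform
family of Clifford+T circuits whose oracle gates are the XOR queries to `A` — Bernstein–Vazirani's
`P ⊆ EQP ⊆ BQP` (reversible simulation) carried out with oracle queries (their oracle QTMs,
§8.3), as used by Fortnow–Rogers ("`BQP` machines can simulate deterministic Turing machines",
§2.3; `P^C = BPP^C = BQP^C`, Thm. 4.2). The unrelativized `P ⊆ BQP` is the tree fact
`Literature.Computability.Cryptography.P_subset_BQP` (discharged in `Cryptography/ClassBQPProofs.lean`).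
[cite: BernsteinVazirani1997SICOMP, Thm. 8.2 (p. 1451) with §8.3 (oracle QTMs)] [cite: FortnowRogers1999JCSS, §2.3 and Thm. 4.2 (arXiv numbering)] -/
def PRel_ofLanguage_subset_BQPRel : Prop :=
  ∀ A : Language Bool, PRel (Oracle.ofLanguage A) ⊆ BQPRel A

/-- **Fortnow–Rogers 1999, Thm. 3.1, relativized**: `BQP^A ⊆ AWPP^A` for every oracle language
`A` ("because Theorem 3.1 relativizes", §3 before Cor. 3.7): by Lemma 3.2 the acceptance
probability of a polynomial-time quantum machine — here a uniform Clifford+T family with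
XOR-query gates to `A` — is `f(x)/D(|x|)` for a `GapP^A` function `f` and a polynomial-time
computable denominator, which after error reduction is Fenner's form of `AWPP^A`. At the empty
oracle this is the tree fact `BQP_subset_AWPP` (`BQP_subset_AWPP_of_BQPRel_subset_AWPPRel`).
[cite: FortnowRogers1999JCSS, Thm. 3.1, Lemma 3.2 and §3 before Cor. 3.7 (arXiv numbering)] [cite: FennerFortnowKurtzLi2003IC, §6.1 p. 25 (BQP ⊆ AWPP)] -/
def BQPRel_subset_AWPPRel : Prop :=
  ∀ A : Language Bool, BQPRel A ⊆ AWPPRel (Oracle.ofLanguage A)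

/-! ### Assembly (proved)

The oracle of the printed proof of Cor. 3.7 — an oracle language `A` (a `PSPACE`-complete set `H`
joined with a Cohen generic `G`, `A = H ⊕ G`) relative to which `P^A = AWPP^A` (Thm. 3.6: "If
`P = PSPACE` (unrelativized) then `P^G = AWPP^G` for any generic `G`", rerelativized to `H`) and
the polynomial-time hierarchy is infinite, `Σₖ^A ≠ Σₖ₊₁^A` for every `k` ("the polynomial-time
hierarchy is infinite relative to generic oracles") — enters as the explicit hypothesis `h₃`
(statement `∃ A, P^A = AWPP^A ∧ ∀ k, Σₖ^A ≠ Σₖ₊₁^A`); it is proved from the two named genericity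
facts downstream (`exists_oracle_PRel_eq_AWPPRel_infinitePH_of_generic`,
`Literature/Barriers/QuantumAdvantage/FortnowRogersOracle.lean`). -/

/-- **The sandwich, oracle-wise**: at every oracle language `A` with `P^A = AWPP^A`,
`P^A ⊆ BQP^A ⊆ AWPP^A = P^A` gives `P^A = BQP^A` ("because Theorem 3.1 relativizes").
[cite: FortnowRogers1999JCSS, §3, proof of Cor. 3.7 (arXiv numbering)] -/
theorem PRel_eq_BQPRel_of_PRel_eq_AWPPRel (h₁ : PRel_ofLanguage_subset_BQPRel)
    (h₂ : BQPRel_subset_AWPPRel) {A : Language Bool}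
    (hA : PRel (Oracle.ofLanguage A) = AWPPRel (Oracle.ofLanguage A)) :
    PRel (Oracle.ofLanguage A) = BQPRel A :=
  Set.Subset.antisymm (h₁ A) (hA ▸ h₂ A)

/-- **Cor. 3.7 from its ingredients**: `P^A ⊆ BQP^A ⊆ AWPP^A = P^A` at the oracle of the
hypothesis `h₃` (`P^A = AWPP^A` with `PH^A` infinite) gives `P^A = BQP^A` with `PH^A` infinite —
literally the definiens of the barrier fact
`Literature.Barriers.QuantumAdvantage.fortnowRogers1999_cor37`.
[cite: FortnowRogers1999JCSS, Cor. 3.7 and its proof, §3 (arXiv numbering)] -/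
theorem exists_oracle_PRel_eq_BQPRel_infinitePH_of_parts (h₁ : PRel_ofLanguage_subset_BQPRel)
    (h₂ : BQPRel_subset_AWPPRel)
    (h₃ : ∃ A : Language Bool, PRel (Oracle.ofLanguage A) = AWPPRel (Oracle.ofLanguage A) ∧
      ∀ k : ℕ, SigmaPRel (Oracle.ofLanguage A) k ≠ SigmaPRel (Oracle.ofLanguage A) (k + 1)) :
    ∃ A : Language Bool, PRel (Oracle.ofLanguage A) = BQPRel A ∧
      ∀ k : ℕ, SigmaPRel (Oracle.ofLanguage A) k ≠ SigmaPRel (Oracle.ofLanguage A) (k + 1) := by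
  obtain ⟨A, hA, hPH⟩ := h₃
  exact ⟨A, PRel_eq_BQPRel_of_PRel_eq_AWPPRel h₁ h₂ hA, hPH⟩

/-- The `P = BQP` half alone: from an oracle with `P^A = AWPP^A`, an oracle with `P^A = BQP^A`
(and `BQP^A = AWPP^A`). [cite: FortnowRogers1999JCSS, Cor. 3.7 (arXiv numbering)] -/
theorem exists_oracle_PRel_eq_BQPRel_eq_AWPPRel_of_parts (h₁ : PRel_ofLanguage_subset_BQPRel)
    (h₂ : BQPRel_subset_AWPPRel)
    (h₃ : ∃ A : Language Bool, PRel (Oracle.ofLanguage A) = AWPPRel (Oracle.ofLanguage A)) :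
    ∃ A : Language Bool, PRel (Oracle.ofLanguage A) = BQPRel A ∧
      BQPRel A = AWPPRel (Oracle.ofLanguage A) := by
  obtain ⟨A, hA⟩ := h₃
  have hPB : PRel (Oracle.ofLanguage A) = BQPRel A := PRel_eq_BQPRel_of_PRel_eq_AWPPRel h₁ h₂ hA
  exact ⟨A, hPB, hPB ▸ hA⟩

/-- Consistency check: the relativized Thm. 3.1 at the empty oracle is the tree's unrelativized
fact `BQP_subset_AWPP` (**S17**), through `BQP ⊆ BQP^0` (`BQP_subset_BQPRel`, proved in
`ClassBQP.lean`) and `AWPP^∅ = AWPP` (`AWPPRel_empty`, under `PRel_empty`).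
[cite: FortnowRogers1999JCSS, Thm. 3.1 (arXiv numbering)] -/
theorem BQP_subset_AWPP_of_BQPRel_subset_AWPPRel (h : BQPRel_subset_AWPPRel) (hE : PRel_empty) :
    BQP_subset_AWPP := by
  intro L hL
  have h0 : L ∈ AWPPRel (Oracle.ofLanguage 0) := h 0 (BQP_subset_BQPRel 0 hL)
  rwa [AWPPRel_ofLanguage_zero hE] at h0

/-! ### Revision 2: the leaf `BPP^A ⊆ BQP^A` shared with Fortnow–Rogers Thm. 4.2 -/

/-- **`BPP^A ⊆ BQP^A` for every oracle language `A`** (Bernstein–Vazirani, Thm. 8.3 `BPP ⊆ BQP`,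
carried out with oracle queries, §8.3; used tacitly by Fortnow–Rogers — proof of Thm. 4.2, p. 7:
"a relativization that identifies `P` and `PSPACE` (and so `P = BPP = BQP`)", and as `P ⊆ BQP`
relative to the oracle of Cor. 3.7): in the tree's models,
a `bp (P^A)` language (G01 transcript machine with oracle `Oracle.ofLanguage A` reading `p(|x|)`
random bits, correct with probability `≥ 2/3`) is decided with error `≤ 1/3` by a polynomial-time
uniform family of Clifford+T circuits with XOR-query gates to `A` (Hadamard coins, reversible
simulation of the rounds, one oracle gate per query). The unrelativized twin is the tree fact
`BPP_subset_BQP` (`BQP.lean`), discharged in `SimUniformity.lean` (`BPP_subset_BQP_holds`); see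
`BPP_subset_BQP_of_BPPRel` for the anchor.
[cite: BernsteinVazirani1997SICOMP, Thm. 8.3 (p. 1451) with §8.3 (oracle QTMs)] [cite: FortnowRogers1999JCSS, Thm. 4.2 and its proof, p. 7 (arXiv numbering)] -/
def BPPRel_ofLanguage_subset_BQPRel : Prop :=
  ∀ A : Language Bool, BPPRel (Oracle.ofLanguage A) ⊆ BQPRel A

/-- `P^A ⊆ BQP^A` (the ingredient `PRel_ofLanguage_subset_BQPRel`) from `BPP^A ⊆ BQP^A` and the
tree fact `P^O ⊆ BPP^O` (`PRel_subset_BPPRel`, discharged as `PRel_subset_BPPRel_holds`,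
`Complexity/OracleBPP.lean`). [cite: BernsteinVazirani1997SICOMP, Thm. 8.2 and Thm. 8.3 (p. 1451)] -/
theorem PRel_ofLanguage_subset_BQPRel_of_BPPRel (h : BPPRel_ofLanguage_subset_BQPRel)
    (hPB : PRel_subset_BPPRel) : PRel_ofLanguage_subset_BQPRel :=
  fun A => (hPB (Oracle.ofLanguage A)).trans (h A)

/-- Anchor: at the empty oracle (`Oracle.empty = Oracle.ofLanguage 0`) the fact is the tree's
unrelativized `BPP ⊆ BQP` (the definiens of `BPP_subset_BQP`), through `P^∅ = P` (`PRel_empty`,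
so `BPP^∅ = bp P = BPP`) and `BQP^0 = BQP` (`BQPRel_zero`), both hypotheses.
[cite: BernsteinVazirani1997SICOMP, Thm. 8.3 (p. 1451)] -/
theorem BPP_subset_BQP_of_BPPRel (h : BPPRel_ofLanguage_subset_BQPRel) (hE : PRel_empty)
    (h0 : BQPRel_zero) : BPP ⊆ BQP := by
  intro L hL
  have hE' : PRel Oracle.empty = P := hE
  have h1 : L ∈ BPPRel (Oracle.ofLanguage 0) := by
    change L ∈ bp (PRel Oracle.empty)
    rw [hE']
    exact hL
  have h2 : L ∈ BQPRel 0 := h 0 h1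
  rwa [show BQPRel 0 = BQP from h0] at h2

/-- **Cor. 3.7 with `BPP` sandwiched**: `P^A ⊆ BPP^A ⊆ BQP^A ⊆ AWPP^A = P^A` at the oracle of
the hypothesis `h₃` (`P^A = AWPP^A` with `PH^A` infinite) gives `P^A = BPP^A = BQP^A` with `PH^A`
infinite (the shape `P = BPP = BQP` printed for the oracle of Thm. 4.2), from the leaf
`BPP^A ⊆ BQP^A`, the relativized Thm. 3.1 and the tree fact `P^O ⊆ BPP^O`.
[cite: FortnowRogers1999JCSS, Cor. 3.7 and its proof, §3 p. 5; Thm. 4.2 p. 7 (arXiv numbering)] -/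
theorem exists_oracle_PRel_eq_BPPRel_eq_BQPRel_infinitePH_of_parts
    (h₁ : BPPRel_ofLanguage_subset_BQPRel) (hPB : PRel_subset_BPPRel) (h₂ : BQPRel_subset_AWPPRel)
    (h₃ : ∃ A : Language Bool, PRel (Oracle.ofLanguage A) = AWPPRel (Oracle.ofLanguage A) ∧
      ∀ k : ℕ, SigmaPRel (Oracle.ofLanguage A) k ≠ SigmaPRel (Oracle.ofLanguage A) (k + 1)) :
    ∃ A : Language Bool, PRel (Oracle.ofLanguage A) = BPPRel (Oracle.ofLanguage A) ∧
      BPPRel (Oracle.ofLanguage A) = BQPRel A ∧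
        ∀ k : ℕ, SigmaPRel (Oracle.ofLanguage A) k ≠ SigmaPRel (Oracle.ofLanguage A) (k + 1) := by
  obtain ⟨A, hA, hPH⟩ := h₃
  have hQP : BQPRel A ⊆ PRel (Oracle.ofLanguage A) := hA ▸ h₂ A
  exact ⟨A, Set.Subset.antisymm (hPB _) ((h₁ A).trans hQP),
    Set.Subset.antisymm (h₁ A) (hQP.trans (hPB _)), hPH⟩

end Literature.Computability.QuantumComplexity

end
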